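import Summits.Ventures.GridStability.Bench.WSCC9Deg4ATrajV2Deg4GE11o8T3o20EXACTRoaModel
import Summits.Ventures.GridStability.Bench.WSCC9Deg4ATrajV2Levelup35o32L30Pp
import HarnessLib
-- PORT HOME/cert/sos-3/closer29200/gen_closer3.py (gridfusion-sos-3 g6) / source WSCC9-deg4-A-trajV2-levelup-35o32-L30-pp.json sha256:6134ee20a27483e8 (+ the V₂ chain b6593c9540996042 / 68f615735a25ed8b)

/-!
# «G1cct-WSCC9-LOWER-K ∀T ≤ 31/200 s» — the V₂ ROA AT LEVEL 35/32 (LEVEL-UP): from sos-1 g10's re-certification `Bench/WSCC9Deg4ATrajV2Levelup35o32L30Pp`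
# to invariance, no pole slip and attraction of the LARGER sublevel piece `{V₂ ≤ 35/32} ∩ {h = 0}`, recast half AND model half

Venture GRIDFUSION (LADDER-GRIDFUSION G1-cct; lead g8 RULINGS 9i (5) «GO LEVELUP», 9t (3); sos-1 g10 RUN 16:10:25Z: A-object
`cert/A/census-newV/WSCC9-deg4-A-trajV2-levelup-35o32-L30-pp.json` file sha256 6134ee20a27483e8…, kit j283343 exact=pass); seat gridfusion-sos-3 (g6), generator
`HOME/cert/sos-3/closer29200/gen_closer3.py`. THE OBJECT: the SAME degree-4 `V₂` as `Bench/WSCC9Deg4ATrajV2Deg4GE11o8T3o20EXACT` (level 18/17), re-certified at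
LEVEL 35/32: `Vdot_neg` on `{V₂ ≤ 35/32} ∩ {0 ≤ dom1} ∩ {κ₂, κ₃ ≤ 3/2} ∩ {h = 0}` and `level_in_ball` (`{V₂ ≤ 35/32} ∩ {h = 0} ⊂ {0 ≤ dom1}`, `dom1 = 11/8 − V₁`)
— NO new `V_pos` (it is the 18/17 file's). READ BACK (generator, exact): every model-block literal of sos-5's staged level-up set (`V`, `Vdot_c0/c1`, `dom1`, `h`,
`f`) is BYTE-IDENTICAL to the 18/17 set's ⇒ this file BRIDGES the level-up decls to the V₂ chain by `rfl` (`…_V_eq`, `…_Vdot_eq`, `…_dom1_eq`, `…_h1_eq'`,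
`…_h2_eq'`) and REUSES the chain's phase-space objects VERBATIM (`deg4_A_trajV2_deg4_GE11o8_T3o20_EXACT_F / Vz / LVz / Wz / M`, continuity, `V(0) = 0`, the keyed Lie link, the first
integrals, the κ-companion link `deg4_A_trajV2_deg4_GE11o8_T3o20_EXACT_dom1_eq_VD`) — only the dissipation inequality, the arc bounds and compactness are re-derived at the larger level
(`‖z‖∞ ≤ 265` from `V_pos`: `φ ≤ 1000·35/32`). Then `Lyapunov.certificate_invariance_tendsto_univ` and, for the model half, the V₂ chain's
`deg4_A_trajV2_deg4_GE11o8_T3o20_EXACT_hasDerivWithinAt_Z` / `…Z_mem_M` and `recast_angle_recovery`.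

THREE COLUMNS. CERTIFIED (kernel, in the Bench files): on `{h = 0} ∩ {V₂ ≤ 35/32}`: `V₁ ≤ 11/8`, hence `κ₂, κ₃ ≤ 3/2`, hence `V̇₂ ≤ −φ/2000`; `V₂ ≥ φ/1000`.
MODELLED: the recast polynomial system of the instance WSCC9-postB-SPdamp-h12 (interface I2) and model-1's `WSCC9.postB_SPdamp.toModel` (MV-2 + MV-P + MV-SPD +
MV-ω + MV-h12). VALIDATED (not here): float margin +0.00096 at 35/32; leg 31's box max 1.198 > 35/32 (sos-1 g10). No sentence here says a machine or a grid is
stable. STATEMENTS: `trajV2lu_roa` / `trajV2lu_roa_arcs` (recast: `0 < γ ≤ 35/32`, `z 0 ∈ M`, `V₂(z 0) ≤ γ` ⇒ `V₂ ≤ γ`, `κ₂, κ₃ ≤ 3/2` ∀t, `z → 0`),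
`trajV2lu_model_roa` (M′: `V₂(Z(c 0)) ≤ γ`, `|u_i(0)| < π` ⇒ no pole slip, `u_i → 0`, `ω_j → 0`), `trajV2lu_model_roa_wellPosed` (∃!).
-/

namespace Summit.Ventures.GridStability.Bench.WSCC9

open Set Filter Metric Topology Real
open Summit.Ventures.GridStability.Lyapunov Summit.Ventures.GridStability.Models
open Literature.Computation.Certificates Literature.Computation.Certificates.SOS

noncomputable section

/-! ### The level-up decls ARE the V₂ chain's decls (byte-identical literals ⇒ `rfl`) -/

/-- The level-up file's `V` IS the V₂ chain's `V` (same 253-term literal). [folklore] -/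
theorem deg4_A_trajV2_levelup_35o32_L30_pp_V_eq (sigma_2 kappa_2 sigma_3 kappa_3 omega_1 omega_2 omega_3 : ℝ) : deg4_A_trajV2_levelup_35o32_L30_pp_V sigma_2 kappa_2 sigma_3 kappa_3 omega_1 omega_2 omega_3 = deg4_A_trajV2_deg4_GE11o8_T3o20_EXACT_V sigma_2 kappa_2 sigma_3 kappa_3 omega_1 omega_2 omega_3 := rfl

/-- The level-up file's `V̇` IS the V₂ chain's `V̇` (same 663-term literal, same chunking). [folklore] -/
theorem deg4_A_trajV2_levelup_35o32_L30_pp_Vdot_eq (sigma_2 kappa_2 sigma_3 kappa_3 omega_1 omega_2 omega_3 : ℝ) : deg4_A_trajV2_levelup_35o32_L30_pp_Vdot sigma_2 kappa_2 sigma_3 kappa_3 omega_1 omega_2 omega_3 = deg4_A_trajV2_deg4_GE11o8_T3o20_EXACT_Vdot sigma_2 kappa_2 sigma_3 kappa_3 omega_1 omega_2 omega_3 := rfl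

/-- The level-up file's named domain polynomial `dom1` IS the V₂ chain's (`= 11/8 − V₁`). [folklore] -/
theorem deg4_A_trajV2_levelup_35o32_L30_pp_dom1_eq (sigma_2 kappa_2 sigma_3 kappa_3 omega_1 omega_2 omega_3 : ℝ) : deg4_A_trajV2_levelup_35o32_L30_pp_dom1 sigma_2 kappa_2 sigma_3 kappa_3 omega_1 omega_2 omega_3 = deg4_A_trajV2_deg4_GE11o8_T3o20_EXACT_dom1 sigma_2 kappa_2 sigma_3 kappa_3 omega_1 omega_2 omega_3 := rfl

/-- The level-up file's `h₁` IS the V₂ chain's `h₁`. [folklore] -/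
theorem deg4_A_trajV2_levelup_35o32_L30_pp_h1_eq' (sigma_2 kappa_2 sigma_3 kappa_3 omega_1 omega_2 omega_3 : ℝ) : deg4_A_trajV2_levelup_35o32_L30_pp_h1 sigma_2 kappa_2 sigma_3 kappa_3 omega_1 omega_2 omega_3 = deg4_A_trajV2_deg4_GE11o8_T3o20_EXACT_h1 sigma_2 kappa_2 sigma_3 kappa_3 omega_1 omega_2 omega_3 := rfl

/-- The level-up file's `h₂` IS the V₂ chain's `h₂`. [folklore] -/
theorem deg4_A_trajV2_levelup_35o32_L30_pp_h2_eq' (sigma_2 kappa_2 sigma_3 kappa_3 omega_1 omega_2 omega_3 : ℝ) : deg4_A_trajV2_levelup_35o32_L30_pp_h2 sigma_2 kappa_2 sigma_3 kappa_3 omega_1 omega_2 omega_3 = deg4_A_trajV2_deg4_GE11o8_T3o20_EXACT_h2 sigma_2 kappa_2 sigma_3 kappa_3 omega_1 omega_2 omega_3 := rfl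

/-- The level-up level `c⁺ = 35/32`. [folklore] -/
def trajV2lu_level : ℝ := (35 / 32 : ℝ)

/-! ### Algebraic consequences at the larger level -/

/-- `V₁ ≤ 11/8` on `M ∩ {V₂ ≤ 35/32}` (CERTIFIED input: the level-up `level_in_ball`, + the chain's link `dom1 = 11/8 − V₁`). [folklore] -/
theorem trajV2lu_VD_le {z : Fin 7 → ℝ} (hz : z ∈ deg4_A_trajV2_deg4_GE11o8_T3o20_EXACT_M) (hV : deg4_A_trajV2_deg4_GE11o8_T3o20_EXACT_Vz z ≤ trajV2lu_level) :
    deg4_A_recertV1_deg4_GE11o8_kappa_incl_pp_V (z 0) (z 1) (z 2) (z 3) (z 4) (z 5) (z 6) ≤ (11 / 8 : ℝ) := by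
  have hD1 := deg4_A_trajV2_levelup_35o32_L30_pp_level_in_ball (z 0) (z 1) (z 2) (z 3) (z 4) (z 5) (z 6) hV hz.1 hz.2
  rw [deg4_A_trajV2_levelup_35o32_L30_pp_dom1_eq] at hD1
  have e := deg4_A_trajV2_deg4_GE11o8_T3o20_EXACT_dom1_eq_VD (z 0) (z 1) (z 2) (z 3) (z 4) (z 5) (z 6)
  linarith

/-- Arc exclusion on the larger piece: `κ₂ ≤ 3/2` (κ-companion `dom_incl_0`). [folklore] -/
theorem trajV2lu_arc_kappa_2 {z : Fin 7 → ℝ} (hz : z ∈ deg4_A_trajV2_deg4_GE11o8_T3o20_EXACT_M) (hV : deg4_A_trajV2_deg4_GE11o8_T3o20_EXACT_Vz z ≤ trajV2lu_level) : z 1 ≤ ((3 : ℝ) / 2) := by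
  have h := deg4_A_recertV1_deg4_GE11o8_kappa_incl_pp_dom_incl_0 (z 0) (z 1) (z 2) (z 3) (z 4) (z 5) (z 6) (trajV2lu_VD_le hz hV) (by rw [deg4_A_trajV2_deg4_GE11o8_T3o20_EXACT_h1_KAP]; exact hz.1) (by rw [deg4_A_trajV2_deg4_GE11o8_T3o20_EXACT_h2_KAP]; exact hz.2)
  linarith

/-- Arc exclusion on the larger piece: `κ₃ ≤ 3/2` (κ-companion `dom_incl_1`). [folklore] -/
theorem trajV2lu_arc_kappa_3 {z : Fin 7 → ℝ} (hz : z ∈ deg4_A_trajV2_deg4_GE11o8_T3o20_EXACT_M) (hV : deg4_A_trajV2_deg4_GE11o8_T3o20_EXACT_Vz z ≤ trajV2lu_level) : z 3 ≤ ((3 : ℝ) / 2) := by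
  have h := deg4_A_recertV1_deg4_GE11o8_kappa_incl_pp_dom_incl_1 (z 0) (z 1) (z 2) (z 3) (z 4) (z 5) (z 6) (trajV2lu_VD_le hz hV) (by rw [deg4_A_trajV2_deg4_GE11o8_T3o20_EXACT_h1_KAP]; exact hz.1) (by rw [deg4_A_trajV2_deg4_GE11o8_T3o20_EXACT_h2_KAP]; exact hz.2)
  linarith

/-- Dissipation in bridge form on `M ∩ {V₂ ≤ 35/32}`: `LV ≤ −W` (CERTIFIED input: the level-up `Vdot_neg`, its three domain hypotheses discharged). [folklore] -/
theorem trajV2lu_LVz_le {z : Fin 7 → ℝ} (hz : z ∈ deg4_A_trajV2_deg4_GE11o8_T3o20_EXACT_M) (hV : deg4_A_trajV2_deg4_GE11o8_T3o20_EXACT_Vz z ≤ trajV2lu_level) :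
    deg4_A_trajV2_deg4_GE11o8_T3o20_EXACT_LVz z ≤ -deg4_A_trajV2_deg4_GE11o8_T3o20_EXACT_Wz z := by
  have hD1 := deg4_A_trajV2_levelup_35o32_L30_pp_level_in_ball (z 0) (z 1) (z 2) (z 3) (z 4) (z 5) (z 6) hV hz.1 hz.2
  have hD2 : 0 ≤ (-1 : ℝ) * z 1 + ((3 : ℝ) / 2) := by have h := trajV2lu_arc_kappa_2 hz hV; linarith
  have hD3 : 0 ≤ (-1 : ℝ) * z 3 + ((3 : ℝ) / 2) := by have h := trajV2lu_arc_kappa_3 hz hV; linarith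
  have h := deg4_A_trajV2_levelup_35o32_L30_pp_Vdot_neg (z 0) (z 1) (z 2) (z 3) (z 4) (z 5) (z 6) hV hD1 hD2 hD3 hz.1 hz.2
  rw [deg4_A_trajV2_levelup_35o32_L30_pp_Vdot_eq] at h
  simp only [deg4_A_trajV2_deg4_GE11o8_T3o20_EXACT_LVz, deg4_A_trajV2_deg4_GE11o8_T3o20_EXACT_Wz]
  linarith

/-- Compactness of the larger piece `{z ∈ M | V₂ z ≤ 35/32}` (closed; `φ ≤ 1000·35/32` from `V_pos`, hence `‖z‖∞ ≤ 265`). [folklore] -/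
theorem trajV2lu_isCompact_S : IsCompact {z ∈ deg4_A_trajV2_deg4_GE11o8_T3o20_EXACT_M | deg4_A_trajV2_deg4_GE11o8_T3o20_EXACT_Vz z ≤ trajV2lu_level} := by
  have hMc : IsClosed deg4_A_trajV2_deg4_GE11o8_T3o20_EXACT_M := by
    simp only [deg4_A_trajV2_deg4_GE11o8_T3o20_EXACT_M, deg4_A_trajV2_deg4_GE11o8_T3o20_EXACT_h1_eq, deg4_A_trajV2_deg4_GE11o8_T3o20_EXACT_h2_eq]
    exact (isClosed_eq (by fun_prop) continuous_const).inter
      (isClosed_eq (by fun_prop) continuous_const)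
  have h := isCompact_sublevel_of_norm_le (D := univ) (c := trajV2lu_level) (R := (265 : ℝ)) hMc
    isClosed_univ deg4_A_trajV2_deg4_GE11o8_T3o20_EXACT_continuous_Vz.continuousOn ?_
  · rwa [inter_univ] at h
  rintro z ⟨hz, -⟩ hV
  have hball := deg4_A_trajV2_deg4_GE11o8_T3o20_EXACT_V_pos (z 0) (z 1) (z 2) (z 3) (z 4) (z 5) (z 6) hz.1 hz.2
  have hlev : deg4_A_trajV2_deg4_GE11o8_T3o20_EXACT_Vz z ≤ (35 / 32 : ℝ) := by simpa only [trajV2lu_level] using hV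
  simp only [deg4_A_trajV2_deg4_GE11o8_T3o20_EXACT_Vz] at hlev
  have hb0 : |z 0| ≤ (265 : ℝ) :=
    abs_le.2 (abs_le_of_sq_le_sq' (by nlinarith [hball, hlev, sq_nonneg (z 1), sq_nonneg (z 2), sq_nonneg (z 3), sq_nonneg (z 4), sq_nonneg (z 5), sq_nonneg (z 6)]) (by norm_num))
  have hb1 : |z 1| ≤ (265 : ℝ) :=
    abs_le.2 (abs_le_of_sq_le_sq' (by nlinarith [hball, hlev, sq_nonneg (z 0), sq_nonneg (z 2), sq_nonneg (z 3), sq_nonneg (z 4), sq_nonneg (z 5), sq_nonneg (z 6)]) (by norm_num))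
  have hb2 : |z 2| ≤ (265 : ℝ) :=
    abs_le.2 (abs_le_of_sq_le_sq' (by nlinarith [hball, hlev, sq_nonneg (z 0), sq_nonneg (z 1), sq_nonneg (z 3), sq_nonneg (z 4), sq_nonneg (z 5), sq_nonneg (z 6)]) (by norm_num))
  have hb3 : |z 3| ≤ (265 : ℝ) :=
    abs_le.2 (abs_le_of_sq_le_sq' (by nlinarith [hball, hlev, sq_nonneg (z 0), sq_nonneg (z 1), sq_nonneg (z 2), sq_nonneg (z 4), sq_nonneg (z 5), sq_nonneg (z 6)]) (by norm_num))
  have hb4 : |z 4| ≤ (265 : ℝ) :=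
    abs_le.2 (abs_le_of_sq_le_sq' (by nlinarith [hball, hlev, sq_nonneg (z 0), sq_nonneg (z 1), sq_nonneg (z 2), sq_nonneg (z 3), sq_nonneg (z 5), sq_nonneg (z 6)]) (by norm_num))
  have hb5 : |z 5| ≤ (265 : ℝ) :=
    abs_le.2 (abs_le_of_sq_le_sq' (by nlinarith [hball, hlev, sq_nonneg (z 0), sq_nonneg (z 1), sq_nonneg (z 2), sq_nonneg (z 3), sq_nonneg (z 4), sq_nonneg (z 6)]) (by norm_num))
  have hb6 : |z 6| ≤ (265 : ℝ) :=
    abs_le.2 (abs_le_of_sq_le_sq' (by nlinarith [hball, hlev, sq_nonneg (z 0), sq_nonneg (z 1), sq_nonneg (z 2), sq_nonneg (z 3), sq_nonneg (z 4), sq_nonneg (z 5)]) (by norm_num))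
  refine (pi_norm_le_iff_of_nonneg (by norm_num)).2 fun i ↦ ?_
  rw [Real.norm_eq_abs]
  fin_cases i
  · simpa using hb0
  · simpa using hb1
  · simpa using hb2
  · simpa using hb3
  · simpa using hb4
  · simpa using hb5
  · simpa using hb6

/-! ### The ROA inclusion at level 35/32 (recast coordinates) -/

/-- **V₂ ROA at the LEVEL-UP level (recast).** For every `0 < γ ≤ 35/32` and every solution `z` of the recast system on `[0, ∞)` with `z 0 ∈ M`,
`V₂(z 0) ≤ γ`: `V₂(z t) ≤ γ` for all `t ≥ 0`, and `z t → 0` — the V₂ chain's objects with the level-up dissipation / compactness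
(`Lyapunov.certificate_invariance_tendsto_univ`). No sentence here says a machine or a grid is stable. [folklore] -/
theorem trajV2lu_roa {γ : ℝ} (hγ0 : 0 < γ) (hγ : γ ≤ trajV2lu_level) {z : ℝ → Fin 7 → ℝ}
    (hzc : ContinuousOn z (Ici 0))
    (hz : ∀ t, 0 ≤ t → HasDerivWithinAt z (deg4_A_trajV2_deg4_GE11o8_T3o20_EXACT_F (z t)) (Ici t) t)
    (h0M : z 0 ∈ deg4_A_trajV2_deg4_GE11o8_T3o20_EXACT_M) (h0V : deg4_A_trajV2_deg4_GE11o8_T3o20_EXACT_Vz (z 0) ≤ γ) :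
    (∀ t, 0 ≤ t → deg4_A_trajV2_deg4_GE11o8_T3o20_EXACT_Vz (z t) ≤ γ) ∧ Tendsto z atTop (𝓝 0) := by
  have hF : Continuous deg4_A_trajV2_deg4_GE11o8_T3o20_EXACT_F := by
    refine continuous_pi fun i ↦ ?_
    fin_cases i <;> simp [deg4_A_trajV2_deg4_GE11o8_T3o20_EXACT_F, deg4_A_trajV2_deg4_GE11o8_T3o20_EXACT_f_sigma_2_eq, deg4_A_trajV2_deg4_GE11o8_T3o20_EXACT_f_kappa_2_eq, deg4_A_trajV2_deg4_GE11o8_T3o20_EXACT_f_sigma_3_eq, deg4_A_trajV2_deg4_GE11o8_T3o20_EXACT_f_kappa_3_eq, deg4_A_trajV2_deg4_GE11o8_T3o20_EXACT_f_omega_1_eq, deg4_A_trajV2_deg4_GE11o8_T3o20_EXACT_f_omega_2_eq, deg4_A_trajV2_deg4_GE11o8_T3o20_EXACT_f_omega_3_eq] <;> fun_prop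
  have hV : Continuous deg4_A_trajV2_deg4_GE11o8_T3o20_EXACT_Vz := deg4_A_trajV2_deg4_GE11o8_T3o20_EXACT_continuous_Vz
  have hW : Continuous deg4_A_trajV2_deg4_GE11o8_T3o20_EXACT_Wz := by unfold deg4_A_trajV2_deg4_GE11o8_T3o20_EXACT_Wz; fun_prop
  have h0 : (0 : Fin 7 → ℝ) ∈ deg4_A_trajV2_deg4_GE11o8_T3o20_EXACT_M := by simp [deg4_A_trajV2_deg4_GE11o8_T3o20_EXACT_M, deg4_A_trajV2_deg4_GE11o8_T3o20_EXACT_h1_eq, deg4_A_trajV2_deg4_GE11o8_T3o20_EXACT_h2_eq]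
  have hMc : IsClosed deg4_A_trajV2_deg4_GE11o8_T3o20_EXACT_M := by
    simp only [deg4_A_trajV2_deg4_GE11o8_T3o20_EXACT_M, deg4_A_trajV2_deg4_GE11o8_T3o20_EXACT_h1_eq, deg4_A_trajV2_deg4_GE11o8_T3o20_EXACT_h2_eq]
    exact (isClosed_eq (by fun_prop) continuous_const).inter
      (isClosed_eq (by fun_prop) continuous_const)
  have hSγ : IsCompact {y ∈ deg4_A_trajV2_deg4_GE11o8_T3o20_EXACT_M | deg4_A_trajV2_deg4_GE11o8_T3o20_EXACT_Vz y ≤ γ} :=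
    trajV2lu_isCompact_S.of_isClosed_subset (hMc.inter (isClosed_le hV continuous_const))
      (fun y hy ↦ ⟨hy.1, hy.2.trans hγ⟩)
  have h := certificate_invariance_tendsto_univ (M := deg4_A_trajV2_deg4_GE11o8_T3o20_EXACT_M) (LV := deg4_A_trajV2_deg4_GE11o8_T3o20_EXACT_LVz) (W := deg4_A_trajV2_deg4_GE11o8_T3o20_EXACT_Wz)
    (x₀ := 0) hSγ hF.continuousOn hV.continuousOn hW.continuousOn
    (fun y hy hVy ↦ trajV2lu_LVz_le hy (hVy.trans hγ))
    (fun y _ _ ↦ by simp only [deg4_A_trajV2_deg4_GE11o8_T3o20_EXACT_Wz]; positivity)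
    (fun y _ hVy ↦ deg4_A_trajV2_deg4_GE11o8_T3o20_EXACT_Wz_pos hγ0 hVy)
    h0 (by rw [deg4_A_trajV2_deg4_GE11o8_T3o20_EXACT_Vz_zero]; exact hγ0.le) (by simp [deg4_A_trajV2_deg4_GE11o8_T3o20_EXACT_Wz])
    (fun y _ _ hWy ↦ deg4_A_trajV2_deg4_GE11o8_T3o20_EXACT_eq_zero_of_Wz hWy)
    hzc hz (fun t ht ↦ deg4_A_trajV2_deg4_GE11o8_T3o20_EXACT_hasDerivWithinAt_Vz (hz t ht)) (deg4_A_trajV2_deg4_GE11o8_T3o20_EXACT_mem_M hzc hz h0M) h0V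
  exact ⟨fun t ht ↦ h.1 t ht, h.2⟩

/-- Arc bounds along the larger piece: `κ₂, κ₃ ≤ 3/2` for all `t ≥ 0`. [folklore] -/
theorem trajV2lu_roa_arcs {γ : ℝ} (hγ0 : 0 < γ) (hγ : γ ≤ trajV2lu_level) {z : ℝ → Fin 7 → ℝ}
    (hzc : ContinuousOn z (Ici 0))
    (hz : ∀ t, 0 ≤ t → HasDerivWithinAt z (deg4_A_trajV2_deg4_GE11o8_T3o20_EXACT_F (z t)) (Ici t) t)
    (h0M : z 0 ∈ deg4_A_trajV2_deg4_GE11o8_T3o20_EXACT_M) (h0V : deg4_A_trajV2_deg4_GE11o8_T3o20_EXACT_Vz (z 0) ≤ γ) :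
    (∀ t, 0 ≤ t → deg4_A_trajV2_deg4_GE11o8_T3o20_EXACT_Vz (z t) ≤ γ ∧ (z t 1 ≤ ((3 : ℝ) / 2) ∧ z t 3 ≤ ((3 : ℝ) / 2))) ∧
      Tendsto z atTop (𝓝 0) := by
  obtain ⟨hinv, hlim⟩ := trajV2lu_roa hγ0 hγ hzc hz h0M h0V
  have hM := deg4_A_trajV2_deg4_GE11o8_T3o20_EXACT_mem_M hzc hz h0M
  refine ⟨fun t ht ↦ ⟨hinv t ht, ?_, ?_⟩, hlim⟩
  · exact trajV2lu_arc_kappa_2 (hM t ht) ((hinv t ht).trans hγ)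
  · exact trajV2lu_arc_kappa_3 (hM t ht) ((hinv t ht).trans hγ)

/-! ### The model half (machine coordinates of M′), via the V₂ chain's exact embedding lemmas -/

/-- **V₂ ROA at level 35/32 in original coordinates (3-machine WSCC9), with angle recovery (A6).** For every `0 < γ ≤ 35/32` and every
solution `c` of `WSCC9.postB_SPdamp.toModel` on `[0, ∞)` whose recast initial state has `V₂ ≤ γ` and `|u_i(0)| < π`: `V₂ ≤ γ` along the recast
state for all `t ≥ 0`; no pole slip; `u_i(t) → 0`, `ω_j(t) → 0`. MODELLED: M′ (MV-2 + MV-P + MV-SPD + MV-ω + MV-h12). [folklore] -/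
theorem trajV2lu_model_roa {δs : Fin 3 → ℝ} (hEq : WSCC9.postB_SPdamp.EqData δs)
    {γ : ℝ} (hγ0 : 0 < γ) (hγ : γ ≤ trajV2lu_level)
    {c : ℝ → ClassicalSwing.State 3} (hc : WSCC9.postB_SPdamp.toModel.IsSolutionOn c (Ici 0))
    (h0V : deg4_A_trajV2_deg4_GE11o8_T3o20_EXACT_Vz (deg2_A_SPdampH12_Z δs (c 0)) ≤ γ)
    (h0win : ∀ i : Fin 2, |RecastData.u δs (c 0) i.succ| < π) :
    (∀ t, 0 ≤ t → deg4_A_trajV2_deg4_GE11o8_T3o20_EXACT_Vz (deg2_A_SPdampH12_Z δs (c t)) ≤ γ) ∧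
    (∀ i : Fin 2, ∀ t, 0 ≤ t → |RecastData.u δs (c t) i.succ| < π) ∧
    (∀ i : Fin 2, Tendsto (fun t ↦ RecastData.u δs (c t) i.succ) atTop (𝓝 0)) ∧
    (∀ j : Fin 3, Tendsto (fun t ↦ (c t).2 j) atTop (𝓝 0)) := by
  set z : ℝ → Fin 7 → ℝ := fun τ ↦ deg2_A_SPdampH12_Z δs (c τ) with hzdef
  have hcc : ContinuousOn c (Ici 0) := fun t ht ↦ (hc t ht).continuousWithinAt
  have hzc : ContinuousOn z (Ici 0) := by
    have h : Continuous fun x : ClassicalSwing.State 3 ↦ deg2_A_SPdampH12_Z δs x := by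
      refine continuous_pi fun k ↦ ?_
      fin_cases k <;> simp [deg2_A_SPdampH12_Z_0, deg2_A_SPdampH12_Z_1, deg2_A_SPdampH12_Z_2,
        deg2_A_SPdampH12_Z_3, deg2_A_SPdampH12_Z_4, deg2_A_SPdampH12_Z_5, deg2_A_SPdampH12_Z_6,
        RecastData.u] <;> fun_prop
    exact h.comp_continuousOn hcc
  have hz : ∀ t, 0 ≤ t → HasDerivWithinAt z (deg4_A_trajV2_deg4_GE11o8_T3o20_EXACT_F (z t)) (Ici t) t := fun t ht ↦
    (deg4_A_trajV2_deg4_GE11o8_T3o20_EXACT_hasDerivWithinAt_Z hEq hc ht).mono (Ici_subset_Ici.2 ht)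
  obtain ⟨hinv, hlim⟩ := trajV2lu_roa_arcs hγ0 hγ hzc hz (deg4_A_trajV2_deg4_GE11o8_T3o20_EXACT_Z_mem_M δs (c 0)) h0V
  have hlim' : ∀ k : ℕ, k < 7 → Tendsto (fun t ↦ RecastData.embed δs (c t) k) atTop (𝓝 0) := by
    intro k hk
    have hall := tendsto_pi_nhds.1 hlim
    interval_cases k
    · simpa [hzdef, deg2_A_SPdampH12_embed_0] using hall 0
    · simpa [hzdef, deg2_A_SPdampH12_embed_1] using hall 1
    · simpa [hzdef, deg2_A_SPdampH12_embed_2] using hall 2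
    · simpa [hzdef, deg2_A_SPdampH12_embed_3] using hall 3
    · simpa [hzdef, deg2_A_SPdampH12_embed_4] using hall 4
    · simpa [hzdef, deg2_A_SPdampH12_embed_5] using hall 5
    · simpa [hzdef, deg2_A_SPdampH12_embed_6] using hall 6
  have hκ : ∀ i : Fin 2, ∀ t, 0 ≤ t → RecastData.embed δs (c t) (2 * i.val + 1) < 2 := by
    intro i t ht
    obtain ⟨-, harc⟩ := hinv t ht
    fin_cases i
    · have h := harc
      simp only [hzdef, deg2_A_SPdampH12_Z_1, deg2_A_SPdampH12_Z_3] at h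
      show RecastData.embed δs (c t) 1 < 2
      rw [deg2_A_SPdampH12_embed_1]
      linarith [h.1]
    · have h := harc
      simp only [hzdef, deg2_A_SPdampH12_Z_1, deg2_A_SPdampH12_Z_3] at h
      show RecastData.embed δs (c t) 3 < 2
      rw [deg2_A_SPdampH12_embed_3]
      linarith [h.2]
  have hrec := recast_angle_recovery δs hcc hlim' hκ h0win
  exact ⟨fun t ht ↦ (hinv t ht).1, hrec.1, hrec.2.1, hrec.2.2⟩

/-- **V₂ ROA at level 35/32, well-posed form (∃!)** at the canonical angles `WSCC9.postB_SPdamp.angleOf` (`ClassicalSwing.existsUnique_and_forall`). [folklore] -/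
theorem trajV2lu_model_roa_wellPosed {γ : ℝ} (hγ0 : 0 < γ) (hγ : γ ≤ trajV2lu_level) {x₀ : ClassicalSwing.State 3}
    (hV : deg4_A_trajV2_deg4_GE11o8_T3o20_EXACT_Vz (deg2_A_SPdampH12_Z WSCC9.postB_SPdamp.angleOf x₀) ≤ γ)
    (hwin : ∀ i : Fin 2, |RecastData.u WSCC9.postB_SPdamp.angleOf x₀ i.succ| < π) :
    (∃! c : ℝ → ClassicalSwing.State 3, c 0 = x₀ ∧ WSCC9.postB_SPdamp.toModel.IsSolutionOn c univ) ∧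
    ∀ c : ℝ → ClassicalSwing.State 3, c 0 = x₀ → WSCC9.postB_SPdamp.toModel.IsSolutionOn c univ →
      (∀ t, 0 ≤ t → deg4_A_trajV2_deg4_GE11o8_T3o20_EXACT_Vz (deg2_A_SPdampH12_Z WSCC9.postB_SPdamp.angleOf (c t)) ≤ γ) ∧
      (∀ i : Fin 2, ∀ t, 0 ≤ t → |RecastData.u WSCC9.postB_SPdamp.angleOf (c t) i.succ| < π) ∧
      (∀ i : Fin 2, Tendsto (fun t ↦ RecastData.u WSCC9.postB_SPdamp.angleOf (c t) i.succ) atTop (𝓝 0)) ∧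
      (∀ j : Fin 3, Tendsto (fun t ↦ (c t).2 j) atTop (𝓝 0)) :=
  ClassicalSwing.existsUnique_and_forall WSCC9.postB_SPdamp.toModel
    (I := fun x ↦ deg4_A_trajV2_deg4_GE11o8_T3o20_EXACT_Vz (deg2_A_SPdampH12_Z WSCC9.postB_SPdamp.angleOf x) ≤ γ ∧
      ∀ i : Fin 2, |RecastData.u WSCC9.postB_SPdamp.angleOf x i.succ| < π)
    (fun _ hc hI ↦ trajV2lu_model_roa WSCC9.postB_SPdamp_eqData hγ0 hγ (hc.mono (subset_univ _)) hI.1 hI.2) ⟨hV, hwin⟩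

end

end Summit.Ventures.GridStability.Bench.WSCC9
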